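import Summits.CriticalPhenomena.SAWScalingLimit.Theses.SAWSteinDefect
import Summits.CriticalPhenomena.SAWScalingLimit.Theorems.SAWLoopFugacityFlowSLEAvoidanceValue

/-!
# `SAWSteinDefect.SLEAvoidanceValue` (stmt-CriticalPhenomena-4986): the SLE_{8/3} value of the
hull-avoidance probability, `pullbackHull` form

Route `SAWSteinDefect` of `CriticalPhenomena/SAWScalingLimit`, support item `SLEAvoidanceValue`
(shared statement item stmt-CriticalPhenomena-4986) — G. F. Lawler, O. Schramm, W. Werner,
*Conformal restriction: the chordal case*, J. Amer. Math. Soc. **16** (2003), Thm. 6.1 (p. 23),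
transposed to a Dobrushin domain `(D; a, b)` and a subdomain `D' ⊆ D` with the same marked points
agreeing with `D` in ε-balls around them: for `μ` the chordal SLE_{8/3} law of `D`, `φ` ANY chordal
uniformizing map of `(D; a, b)`, `A = φ.pullbackHull D'` the pulled-back hull and `(Φ, d)`
restriction data of `A` (`IsRestrictionMap A Φ`, `HasRestrictionDeriv A Φ d`),
`μ {Γ ⊆ closure D'} = ENNReal.ofReal (d ^ (5/8))`.

## Proof

This is the `A := φ.pullbackHull D'` instance of the sibling route's item
`SAWLoopFugacityFlow.SLEAvoidanceValue` (stmt-CriticalPhenomena-10651, hull quantified as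
`∀ A, A = closure (ℍ ∖ φ⁻¹(D')) → …`), proved in the tree as
`Summit.CriticalPhenomena.SAWScalingLimit.Theorems.SLEAvoidanceValue_proof`
(`Theorems/SAWLoopFugacityFlowSLEAvoidanceValue.lean`: re-realise `μ` through the given `φ` by
uniqueness in law of chordal SLE, identify `{Γ ⊆ closure D'}` with `{γ ∩ A = ∅}` up to the null
event "touching without entering", evaluate by [LSW] Thm. 6.1 in the half-plane,
`sle_restriction_eightThirds_holds`). The equation `φ.pullbackHull D' = closure (ℍ ∖ φ⁻¹(D'))`
holds by `rfl` (`ConformalEquiv.pullbackHull`, `ConformalEquiv.pullbackDomain`).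
-/

namespace Summit.CriticalPhenomena.SAWScalingLimit.Theorems

open Literature.Probability.RandomPlanarGeometry

/-- **`SAWSteinDefect.SLEAvoidanceValue` (stmt-CriticalPhenomena-4986) holds** — [LSW] Thm. 6.1
transposed to hull subdomains, VALUE form with the hull written as `φ.pullbackHull D'`: for `μ` the
chordal SLE_{8/3} law of `(D; a, b)`, `D' ⊆ D` with the same marked points agreeing with `D` near
them, `φ` any chordal uniformizing map of `(D; a, b)` and restriction data `(Φ, d)` of
`φ.pullbackHull D'`, `μ {Γ ⊆ closure D'} = ENNReal.ofReal (d ^ (5/8))`. It is the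
`A := φ.pullbackHull D'`, `rfl` instance of the tree's `SLEAvoidanceValue_proof` (sibling route
`SAWLoopFugacityFlow`, stmt-CriticalPhenomena-10651).
G. F. Lawler, O. Schramm, W. Werner, J. Amer. Math. Soc. 16 (2003), Thm. 6.1 (p. 23). -/
theorem SLEAvoidanceValue_pullbackHull_proof :
    Summit.CriticalPhenomena.SAWScalingLimit.Theses.SAWSteinDefect.SLEAvoidanceValue := by
  unfold Summit.CriticalPhenomena.SAWScalingLimit.Theses.SAWSteinDefect.SLEAvoidanceValue
  intro D D' μ hμ hsub h0 h1 hε φ hφ Φ d hΦ hd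
  have h := SLEAvoidanceValue_proof
  unfold Summit.CriticalPhenomena.SAWScalingLimit.Theses.SAWLoopFugacityFlow.SLEAvoidanceValue at h
  exact h D D' μ hμ hsub h0 h1 hε φ hφ (φ.pullbackHull D') rfl Φ d hΦ hd

end Summit.CriticalPhenomena.SAWScalingLimit.Theorems
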